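import Mathlib.NumberTheory.Real.Irrational
import Mathlib.FieldTheory.KummerPolynomial
import Mathlib.FieldTheory.Relrank
import Literature.NumberTheory.LocalFields.PadicSeventeenRigidSextic
import HarnessLib

/-!
# Frobenioids I, Thm. 6.2 (iii) without "`K̃/K` Galois": the rigid sextic field `ℚ(γ) ⊇ ℚ(√2)` inside `ℚ_17`
# (the number-field input of the base category `FinSubextCat ℚ ℚ_[17]` that is not of FSMFF-type)

Mochizuki, *The geometry of Frobenioids I: the general theory*, Kyushu J. Math. **62** (2008) 293–400,
Example 6.1 p. 109 (standing hypothesis "`K̃` a Galois extension of `K`"), proof of Thm. 6.2 (iii) p. 111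
("every monomorphism of `D` is an isomorphism, hence `D` is of FSM-type [hence also of FSMFF-type]").
[cite: MochizukiFrdI2008, Thm. 6.2 (iii) p.111] The `17`-adic inputs (Hensel's Lemma, roots of unity and cubes
in `ℚ_17`) are `Literature.NumberTheory.LocalFields.padic_seventeen_rigid_sextic`
[cite: Gouvea1993PadicNumbers, Thm. 4.5.2 (Hensel's Lemma)].

PROOF-ONLY (cell abc-iut, block F fact-proving wave, seat abc-iut-f-043; toward FACT-LIST row F-1137
`Thm62iii_L06_standard`). No definitions. Throughout, `s, γ ∈ ℚ_17` with `s² = 2`, `γ³ = 5 + 2s`, no cube root of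
`5 − 2s` in `ℚ_17`, and `γ` the only root in `ℚ_17` of `x⁶ − 10x³ + 17` (hypotheses `hs hγ hN hR`, supplied by
`padic_seventeen_rigid_sextic`). What the kernel records about the subfields `ℚ(s) = ℚ(√2) ≤ ℚ(γ)` of `ℚ_17`:
* `[ℚ(s) : ℚ] = 2` (`√2 ∉ ℚ`), `s ∈ ℚ(γ)`, `γ ∉ ℚ(s)` (the twist `s ↦ −s` of `ℚ(s)` into `ℚ_17` would carry a cube
  root of `5 + 2s` to one of `5 − 2s`), so `x³ − (5 + 2s)` is irreducible over `ℚ(s)` and **`[ℚ(γ) : ℚ] = 6`**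
  (`padic17_finrank_adjoin_γ`);
* **RIGIDITY** (`padic17_algHom_apply_γ`, `padic17_algHom_apply_s`): every `ℚ`-algebra map into `ℚ_17` out of a
  subfield containing `γ` fixes `γ` (its image is a root of the sextic) and hence `s = (γ³ − 5)/2`;
* **the subfield lattice** (`padic17_subfield_eq_adjoin_s`): a subfield `S ≤ ℚ(γ)` of degree `2` or `3` is `ℚ(s)`
  — no cubic subfield (else `ℚ(γ) = S(s)` is quadratic over `S` and the `S`-map `s ↦ −s` contradicts rigidity)
  and a unique quadratic one (`4 ∤ 6`).
So `ℚ(γ)` has a unique embedding into `ℚ_17` while its subfield `ℚ(√2)` has two — the configuration that breaks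
"FSMFF-type" for `D = FinSubextCat ℚ ℚ_[17]` (`FinSubextCatPadicNotFSMFF.lean`). Nothing here bears on
[IUTchIII] Cor. 3.12 or asserts anything about abc.
-/

noncomputable section

namespace Literature.AlgebraicGeometry.Frobenioids

open IntermediateField Polynomial
open Literature.NumberTheory.LocalFields

/-! ### The rigid sextic `ℚ(γ) ⊇ ℚ(√2)` inside `ℚ_17` -/

/-- `2` is not a square in `ℚ` (irrationality of `√2`). [cite: MochizukiFrdI2008, Ex. 6.1 p.109] -/
theorem rat_sq_ne_two (b : ℚ) : b ^ 2 ≠ 2 := by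
  intro hb
  have h : ((|b| : ℚ) : ℝ) = Real.sqrt 2 := by
    rw [Rat.cast_abs, ← Real.sqrt_sq (abs_nonneg (b : ℝ)), sq_abs]
    congr 1
    exact_mod_cast hb
  exact irrational_sqrt_two ⟨|b|, h⟩

/-- Evaluation of the sextic `x⁶ − 10x³ + 17`. [cite: MochizukiFrdI2008, Ex. 6.1 p.109] -/
theorem padic17_aeval_sextic {A : Type*} [CommRing A] [Algebra ℚ A] (y : A) :
    aeval y (X ^ 6 - 10 * X ^ 3 + 17 : ℚ[X]) = y ^ 6 - 10 * y ^ 3 + 17 := by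
  simp only [map_add, map_sub, map_mul, map_pow, aeval_X, map_ofNat]

section Padic17

variable [Fact (Nat.Prime 17)] {s γ : ℚ_[17]} (hs : s ^ 2 = 2) (hγ : γ ^ 3 = 5 + 2 * s)
  (hN : ∀ x : ℚ_[17], x ^ 3 ≠ 5 - 2 * s) (hR : ∀ g : ℚ_[17], g ^ 6 - 10 * g ^ 3 + 17 = 0 → g = γ)

include hs in
/-- `s = √2 ∈ ℚ_17` is integral over `ℚ`, a root of `x² − 2`. [cite: MochizukiFrdI2008, Ex. 6.1 p.109] -/
theorem padic17_isIntegral_s : _root_.IsIntegral ℚ s :=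
  ⟨X ^ 2 - C 2, monic_X_pow_sub_C _ two_ne_zero, by simp [hs]⟩

include hs in
/-- `s ∉ ℚ`. [cite: MochizukiFrdI2008, Ex. 6.1 p.109] -/
theorem padic17_s_not_mem_bot : s ∉ (⊥ : IntermediateField ℚ ℚ_[17]) := by
  rw [IntermediateField.mem_bot]
  rintro ⟨q, hq⟩
  refine rat_sq_ne_two q ((algebraMap ℚ ℚ_[17]).injective ?_)
  rw [map_pow, hq, hs, map_ofNat]

include hs in
/-- `minpoly_ℚ(s) = x² − 2` and `[ℚ(s) : ℚ] = 2`. [cite: MochizukiFrdI2008, Ex. 6.1 p.109] -/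
theorem padic17_adjoin_s_degree : minpoly ℚ s = X ^ 2 - C 2 ∧ Module.finrank ℚ ℚ⟮s⟯ = 2 := by
  have hmin : minpoly ℚ s = X ^ 2 - C 2 :=
    (minpoly.eq_of_irreducible_of_monic (X_pow_sub_C_irreducible_of_prime Nat.prime_two rat_sq_ne_two)
      (by simp [hs]) (monic_X_pow_sub_C _ two_ne_zero)).symm
  refine ⟨hmin, ?_⟩
  rw [adjoin.finrank (padic17_isIntegral_s hs), hmin, natDegree_X_pow_sub_C]

include hs in
/-- `s ≠ 0`, so `s ≠ −s`. [cite: MochizukiFrdI2008, Ex. 6.1 p.109] -/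
theorem padic17_s_ne_neg : s ≠ -s := by
  intro h
  have h0 : s = 0 := by linear_combination h / 2
  rw [h0] at hs
  norm_num at hs

include hs hγ in
/-- `γ` is integral over `ℚ`, a root of `x⁶ − 10x³ + 17 = (x³ − 5)² − 8`. [cite: MochizukiFrdI2008, Ex. 6.1 p.109] -/
theorem padic17_isIntegral_γ : _root_.IsIntegral ℚ γ := by
  refine ⟨X ^ 6 - 10 * X ^ 3 + 17, by monicity!, ?_⟩
  simp only [eval₂_add, eval₂_sub, eval₂_mul, eval₂_X_pow, eval₂_ofNat]
  linear_combination (γ ^ 3 - 5 + 2 * s) * hγ + 4 * hs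

include hs hR in
/-- Uniqueness of the cube root: `x³ = 5 + 2s ⟹ x = γ` (such an `x` is a root of the sextic).
[cite: MochizukiFrdI2008, Thm. 6.2 (iii) p.111] -/
theorem padic17_eq_γ_of_cube {x : ℚ_[17]} (hx : x ^ 3 = 5 + 2 * s) : x = γ :=
  hR x (by linear_combination (x ^ 3 - 5 + 2 * s) * hx + 4 * hs)

include hγ in
/-- `s = (γ³ − 5)/2 ∈ ℚ(γ)`. [cite: MochizukiFrdI2008, Ex. 6.1 p.109] -/
theorem padic17_s_mem_adjoin_γ : s ∈ ℚ⟮γ⟯ := by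
  have h : s = (γ ^ 3 - 5) / 2 := by rw [hγ]; ring
  rw [h]
  exact div_mem (sub_mem (pow_mem (mem_adjoin_simple_self ℚ γ) 3) (ofNat_mem _ 5)) (ofNat_mem _ 2)

include hs hγ hR in
/-- **Rigidity**: a `ℚ`-algebra map into `ℚ_17` out of any subfield containing `γ` fixes `γ` (the image is a root
of the sextic, whose only root in `ℚ_17` is `γ`) … [cite: MochizukiFrdI2008, Thm. 6.2 (iii) p.111] -/
theorem padic17_algHom_apply_γ (E : IntermediateField ℚ ℚ_[17]) (hγE : γ ∈ E) (T : E →ₐ[ℚ] ℚ_[17]) :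
    T ⟨γ, hγE⟩ = γ := by
  apply hR
  have hrel : aeval (⟨γ, hγE⟩ : E) (X ^ 6 - 10 * X ^ 3 + 17 : ℚ[X]) = 0 := by
    apply (algebraMap E ℚ_[17]).injective
    rw [map_zero, ← aeval_algebraMap_apply, IntermediateField.algebraMap_apply, padic17_aeval_sextic]
    linear_combination (γ ^ 3 - 5 + 2 * s) * hγ + 4 * hs
  have h := congrArg T hrel
  rwa [← aeval_algHom_apply, map_zero, padic17_aeval_sextic] at h

include hs hγ hR in
/-- … and therefore fixes `s = (γ³ − 5)/2`. [cite: MochizukiFrdI2008, Thm. 6.2 (iii) p.111] -/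
theorem padic17_algHom_apply_s (E : IntermediateField ℚ ℚ_[17]) (hγE : γ ∈ E) (hsE : s ∈ E)
    (T : E →ₐ[ℚ] ℚ_[17]) : T ⟨s, hsE⟩ = s := by
  have h5 : ((5 : E) : ℚ_[17]) = 5 := rfl
  have h2 : ((2 : E) : ℚ_[17]) = 2 := rfl
  have hrel : (2 : E) * ⟨s, hsE⟩ = (⟨γ, hγE⟩ : E) ^ 3 - 5 := by
    apply Subtype.ext
    simp only [SubmonoidClass.coe_pow, AddSubgroupClass.coe_sub, MulMemClass.coe_mul, h5, h2]
    rw [hγ]; ring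
  have h := congrArg T hrel
  rw [map_mul, map_ofNat, map_sub, map_pow, map_ofNat, padic17_algHom_apply_γ hs hγ hR E hγE T] at h
  linear_combination h / 2 + hγ / 2

include hs in
/-- The minimal polynomial of the power-basis generator of `ℚ(s)` is `x² − 2`.
[cite: MochizukiFrdI2008, Ex. 6.1 p.109] -/
theorem padic17_minpoly_powerBasis_gen :
    minpoly ℚ (adjoin.powerBasis (padic17_isIntegral_s hs)).gen = X ^ 2 - C 2 := by
  rw [adjoin.powerBasis_gen]
  exact (minpoly_gen ℚ s).trans ((padic17_adjoin_s_degree hs).1)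

include hs hγ hN in
/-- The twist of `ℚ(s)`: a `ℚ`-algebra map `ℚ(s) → ℚ_17` with `s ↦ −s`; it shows `γ ∉ ℚ(s)` (a cube root of
`5 + 2s` in `ℚ(s)` would go to a cube root of `5 − 2s`). [cite: MochizukiFrdI2008, Thm. 6.2 (iii) p.111] -/
theorem padic17_γ_not_mem_adjoin_s : γ ∉ ℚ⟮s⟯ := by
  intro hmem
  let pb := adjoin.powerBasis (padic17_isIntegral_s hs)
  have hroot : aeval (-s) (minpoly ℚ pb.gen) = 0 := by
    rw [padic17_minpoly_powerBasis_gen hs]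
    simp only [map_sub, map_pow, aeval_X, map_ofNat, neg_sq, hs, sub_self]
  let τ : ℚ⟮s⟯ →ₐ[ℚ] ℚ_[17] := pb.lift (-s) hroot
  have hτs : τ (AdjoinSimple.gen ℚ s) = -s := by
    rw [← adjoin.powerBasis_gen (padic17_isIntegral_s hs)]
    exact pb.lift_gen (-s) hroot
  have h5 : ((5 : ℚ⟮s⟯) : ℚ_[17]) = 5 := rfl
  have h2 : ((2 : ℚ⟮s⟯) : ℚ_[17]) = 2 := rfl
  have hrel : (⟨γ, hmem⟩ : ℚ⟮s⟯) ^ 3 = 5 + 2 * AdjoinSimple.gen ℚ s := by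
    apply Subtype.ext
    simp only [SubmonoidClass.coe_pow, AddMemClass.coe_add, MulMemClass.coe_mul, h5, h2, AdjoinSimple.coe_gen,
      hγ]
  have h := congrArg τ hrel
  rw [map_pow, map_add, map_mul, map_ofNat, map_ofNat, hτs] at h
  exact hN (τ ⟨γ, hmem⟩) (by rw [h]; ring)

include hs hγ hN hR in
/-- `ℚ(s) < ℚ(γ)` and `[ℚ(γ) : ℚ] = 6 = 2 · 3`: over `ℚ(s)`, `minpoly(γ) = x³ − (5 + 2s)` (irreducible of prime
degree: a root in `ℚ(s)` would be `γ` by uniqueness of the cube root). [cite: MochizukiFrdI2008, Thm. 6.2 (iii) p.111] -/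
theorem padic17_finrank_adjoin_γ : Module.finrank ℚ ℚ⟮γ⟯ = 6 := by
  have hle : ℚ⟮s⟯ ≤ ℚ⟮γ⟯ := adjoin_simple_le_iff.mpr (padic17_s_mem_adjoin_γ hγ)
  -- the cubic step over `ℚ(s)`
  set m' : ℚ⟮s⟯ := 5 + 2 * AdjoinSimple.gen ℚ s with hm'def
  have hm' : (m' : ℚ_[17]) = 5 + 2 * s := by
    have h5 : ((5 : ℚ⟮s⟯) : ℚ_[17]) = 5 := rfl
    have h2 : ((2 : ℚ⟮s⟯) : ℚ_[17]) = 2 := rfl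
    simp only [hm'def, AddMemClass.coe_add, MulMemClass.coe_mul, h5, h2, AdjoinSimple.coe_gen]
  have hirr : Irreducible (X ^ 3 - C m') := by
    refine X_pow_sub_C_irreducible_of_prime Nat.prime_three fun b hb => ?_
    have hb' : (b : ℚ_[17]) ^ 3 = 5 + 2 * s := by
      have := congrArg (fun z : ℚ⟮s⟯ => (z : ℚ_[17])) hb
      simpa [hm'] using this
    have hbγ : (b : ℚ_[17]) = γ := padic17_eq_γ_of_cube hs hR hb'
    exact padic17_γ_not_mem_adjoin_s hs hγ hN (hbγ ▸ b.2)
  have hmonic : (X ^ 3 - C m').Monic := monic_X_pow_sub_C _ three_ne_zero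
  have haeval : aeval γ (X ^ 3 - C m') = 0 := by
    simp only [map_sub, map_pow, aeval_X, aeval_C, IntermediateField.algebraMap_apply, hm', hγ, sub_self]
  have hint : _root_.IsIntegral ℚ⟮s⟯ γ := ⟨X ^ 3 - C m', hmonic, by simpa [aeval_def] using haeval⟩
  have hmin : minpoly ℚ⟮s⟯ γ = X ^ 3 - C m' := (minpoly.eq_of_irreducible_of_monic hirr haeval hmonic).symm
  have h3 : Module.finrank ℚ⟮s⟯ ℚ⟮s⟯⟮γ⟯ = 3 := by
    rw [adjoin.finrank hint, hmin, natDegree_X_pow_sub_C]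
  have hrel : IntermediateField.relfinrank ℚ⟮s⟯ ℚ⟮γ⟯ = 3 := by
    rw [IntermediateField.relfinrank_eq_finrank_of_le hle, extendScalars_adjoin hle, h3]
  have h := IntermediateField.finrank_bot_mul_relfinrank hle
  rw [(padic17_adjoin_s_degree hs).2, hrel] at h
  omega

include hs hγ hN hR in
/-- **No cubic subfield and a unique quadratic subfield.** If `S ≤ ℚ(γ)` has `[S : ℚ] ∈ {2, 3}` then `s ∈ S`
(otherwise `S(s)/S` is quadratic: for `[S:ℚ] = 3` this makes `S(s) = ℚ(γ)` and the `S`-map `s ↦ −s` into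
`ℚ_17` contradicts rigidity; for `[S:ℚ] = 2` it gives `4 ∣ 6`); with `s ∈ S`, `[S:ℚ] = 3` is impossible
(`2 ∣ 3`), so `[S : ℚ] = 2` and `S = ℚ(s)`. [cite: MochizukiFrdI2008, Thm. 6.2 (iii) p.111] -/
theorem padic17_subfield_eq_adjoin_s (S : IntermediateField ℚ ℚ_[17]) (hS : S ≤ ℚ⟮γ⟯)
    (hd : Module.finrank ℚ S = 2 ∨ Module.finrank ℚ S = 3) : S = ℚ⟮s⟯ := by
  haveI : FiniteDimensional ℚ ℚ⟮γ⟯ := adjoin.finiteDimensional (padic17_isIntegral_γ hs hγ)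
  haveI : FiniteDimensional ℚ S :=
    FiniteDimensional.of_injective (IntermediateField.inclusion hS).toLinearMap
      (IntermediateField.inclusion hS).injective
  have h6 := padic17_finrank_adjoin_γ hs hγ hN hR
  -- the extension `ℚ(γ)/S`, of degree `6 / [S:ℚ]`
  have hrelmul := IntermediateField.finrank_bot_mul_relfinrank hS
  rw [h6, IntermediateField.relfinrank_eq_finrank_of_le hS] at hrelmul
  haveI : FiniteDimensional S (extendScalars hS) :=
    FiniteDimensional.of_finrank_pos (by
      rcases hd with hd | hd <;> rw [hd] at hrelmul <;> omega)
  -- `s ∈ S`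
  have hsS : s ∈ S := by
    by_contra hsS
    -- `S(s)/S` is quadratic with the twist `s ↦ -s`
    have hint : _root_.IsIntegral S s := (padic17_isIntegral_s hs).tower_top
    have hirr : Irreducible (X ^ 2 - C (2 : S)) := by
      refine X_pow_sub_C_irreducible_of_prime Nat.prime_two fun b hb => hsS ?_
      have hb' : (b : ℚ_[17]) ^ 2 = s ^ 2 := by
        have := congrArg (fun z : S => (z : ℚ_[17])) hb
        simp only [SubmonoidClass.coe_pow] at this
        rw [this, hs]; norm_cast
      rcases eq_or_eq_neg_of_sq_eq_sq _ _ hb' with h | h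
      · exact h ▸ b.2
      · have : s = -(b : ℚ_[17]) := by rw [h, neg_neg]
        exact this ▸ neg_mem b.2
    have hmonic : (X ^ 2 - C (2 : S)).Monic := monic_X_pow_sub_C _ two_ne_zero
    have haeval : aeval s (X ^ 2 - C (2 : S)) = 0 := by
      simp only [map_sub, map_pow, aeval_X, map_ofNat, hs, sub_self]
    have hmin : minpoly S s = X ^ 2 - C 2 := (minpoly.eq_of_irreducible_of_monic hirr haeval hmonic).symm
    have h2 : Module.finrank S S⟮s⟯ = 2 := by rw [adjoin.finrank hint, hmin, natDegree_X_pow_sub_C]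
    -- `S(s) ≤ ℚ(γ)` over `S`
    have hle : S⟮s⟯ ≤ extendScalars hS := adjoin_simple_le_iff.mpr (padic17_s_mem_adjoin_γ hγ)
    rcases hd with hd | hd
    · -- `[S:ℚ] = 2`: `2 = [S(s):S] ∣ [ℚ(γ):S] = 3`
      rw [hd] at hrelmul
      have h3 : Module.finrank S (extendScalars hS) = 3 := by omega
      have hdvd := IntermediateField.finrank_dvd_of_le_right hle
      rw [h2, h3] at hdvd
      omega
    · -- `[S:ℚ] = 3`: `S(s) = ℚ(γ)` over `S`, and the twist contradicts rigidity
      rw [hd] at hrelmul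
      have h2' : Module.finrank S (extendScalars hS) = 2 := by omega
      have heq : S⟮s⟯ = extendScalars hS := IntermediateField.eq_of_le_of_finrank_eq hle (by rw [h2, h2'])
      have hγmem : γ ∈ S⟮s⟯ := by
        rw [heq, mem_extendScalars]
        exact mem_adjoin_simple_self ℚ γ
      let pb := adjoin.powerBasis hint
      have hmin_gen : minpoly S pb.gen = X ^ 2 - C 2 := by
        rw [adjoin.powerBasis_gen]
        exact (minpoly_gen S s).trans hmin
      have hroot : aeval (-s) (minpoly S pb.gen) = 0 := by
        rw [hmin_gen]
        simp only [map_sub, map_pow, aeval_X, map_ofNat, neg_sq, hs, sub_self]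
      let τ : S⟮s⟯ →ₐ[S] ℚ_[17] := pb.lift (-s) hroot
      have hτs : τ (AdjoinSimple.gen S s) = -s := by
        rw [← adjoin.powerBasis_gen hint]
        exact pb.lift_gen (-s) hroot
      let T : (S⟮s⟯).restrictScalars ℚ →ₐ[ℚ] ℚ_[17] := τ.restrictScalars ℚ
      have hTs : T ⟨s, mem_adjoin_simple_self S s⟩ = s :=
        padic17_algHom_apply_s hs hγ hR ((S⟮s⟯).restrictScalars ℚ) hγmem (mem_adjoin_simple_self S s) T
      have : T ⟨s, mem_adjoin_simple_self S s⟩ = -s := hτs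
      exact padic17_s_ne_neg hs (hTs.symm.trans this)
  -- hence `ℚ(s) ≤ S`, `[S:ℚ] = 2`, `S = ℚ(s)`
  have hle' : ℚ⟮s⟯ ≤ S := adjoin_simple_le_iff.mpr hsS
  have hd2 : Module.finrank ℚ S = 2 := by
    rcases hd with hd | hd
    · exact hd
    · have hdvd := IntermediateField.finrank_dvd_of_le_right hle'
      rw [(padic17_adjoin_s_degree hs).2, hd] at hdvd
      omega
  exact (IntermediateField.eq_of_le_of_finrank_eq hle' (by rw [(padic17_adjoin_s_degree hs).2, hd2])).symm


end Padic17

end Literature.AlgebraicGeometry.Frobenioids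

end
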